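import Summits.ResolutionOfSingularities.ResolutionOfSingularities.Theorems.FrobeniusLadderFInjectiveMacaulayficationX2CubicFormTStepRow
import Summits.ResolutionOfSingularities.ResolutionOfSingularities.Theorems.FrobeniusLadderFInjectiveMacaulayficationX2CubicFormFermat
import Summits.ResolutionOfSingularities.ResolutionOfSingularities.Theorems.FrobeniusLadderFInjectiveMacaulayficationHypersurfaceOriginNotFull
import Summits.ResolutionOfSingularities.ResolutionOfSingularities.Theorems.FrobeniusLadderFInjectiveMacaulayficationRelClosedSubsetFixFinite
import Summits.ResolutionOfSingularities.ResolutionOfSingularities.Theorems.FrobeniusLadderFInjectiveMacaulayficationBrieskornPhamSpecimen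
import HarnessLib

/-!
# THE p = 2 SMOOTH-CUBIC F-SIDE CLASS ROW: for every cubic form `F₃ ∈ (Y₀², …, Y₃²)` (no square-free monomial) with `x² + F₃` prime, isolated, and smooth prime
# dehomogenisations, the vertex of `Y = {x² + F₃ = 0}` is NOT F-pure in characteristic 2 and its POINT FLOOR IS THE CURE (every blowing up along `𝔪̃` FULL at every stalk)
# — UNCONDITIONAL, census currency `¬ FullCl 2 (𝒪_{Y,v}) ∧ FInjectivizationGermAt 2 v`; instance: the Fermat member at `p = 2`
# (crux `FInjectiveMacaulayfication` stmt-ResolutionOfSingularities-15315, chain w45a; res-L1-w45a-plan-1 RULING R22.15 «REGISTER IT … `…X2CubicFormFSideChar2.lean`: (1)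
# `vertex_not_fullCl_char2`, (2) ★ `fSide_classRow_smoothCubic_char2` + `fInjectivizationGermAt_smoothCubic_char2`, (3) instances Fermat / cyclic (p = 2)», reassigned to this
# seat by R22.16 (3); seat res-L1-w45a-stub-1 g14; T-side inputs = res-L1-w45a-lead-1's ✓ `X2CubicFormTStepRow` (p682339), ✓ `X2CubicFormFermat`, ✓ `X2Cubic4FloorTwoYChart`)

[OURS · L1 W4.5a] Support file (`--supports stmt-ResolutionOfSingularities-15315 --as helper`); def-free; UNCONDITIONAL; no named fact; NOT a statement of any manuscript.
HONEST BILLING (R22.15, binding): an F-side class row of the SIMPLEST kind — cure = the point floor, ONE storey, no composite centre — at `p = 2` only; evidence for nothing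
about beds needing composite centres; nothing of the crux is proved. AI-written (AI review is weaker than expert review).

Letters: `F ∈ k[Y₀..Y₃]` a cubic form, `f = X₄² + F(X₀..X₃)`, `Y = Spec k[X]/(f)`, `v` its vertex; the four dehomogenisations `F|_{Y_a = 1} ∈ k[Z₀,Z₁,Z₂]` in lead-1's letter
(`aeval (![![1,X0,X1,X2], ![X0,1,X1,X2], ![X0,X1,1,X2], ![X0,X1,X2,1]] a) F`).
* §1 `mem_span_sq_of_support` (a polynomial all of whose monomials contain a square lies in `(Y₀²,…,Y₃²)`), `rename_mem_span_sq`, ★ `vertex_not_fullCl_char2` — `char k = 2`,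
  `F` homogeneous of degree 3 with `∀ m ∈ supp F, ∃ i, 2 ≤ m i`, `f` prime ⇒ `f ∈ 𝔪^{[2]}` ⇒ `¬ FullCl 2 (𝒪_{Y,v})` (Fedder at the vertex, ✓ `HypersurfaceOriginNotFull`).
* §2 ★ `fSide_classRow_smoothCubic_char2` — `char k = 2`; `F` as in §1 with `Y` regular off `v` and prime, pointwise-smooth dehomogenisations (lead-1's class hypotheses):
  `¬ FullCl 2 (𝒪_{Y,v})` ∧ SCOPE (`v` closed, singular, `dim 𝒪_{Y,v} = 4`) ∧ for EVERY blowing up `g : S′ → Spec 𝒪_{Y,v}` along the point floor: LEGAL (centre `≠ ⊥`, supported in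
  the non-regular locus, `S′` regular off the closed fibre, CM everywhere) ∧ FULL at every stalk — one application of ✓ `X2CubicFormTStepRow.tStep_row_of_doublePoint_cubicForm` (its
  middle conjunct) plus §1; ★ `fInjectivizationGermAt_smoothCubic_char2 : GermForm.FInjectivizationGermAt 2 v` (witness `𝓚 =` the point floor, model `Bl_𝔪 Y` FULL by lead-1's
  ✓ `affineBlowup_fullCl`, ✓ `GermOfGlobalBlowup.fInjectivizationGermAt_of_affineBlowup`); ★ `smoothCubic_bad_germ_row_char2` = the census pair `¬ FullCl 2 ∧ FInjectivizationGermAt 2 v`.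
* §3 the FERMAT MEMBER at `p = 2`: `f = X₄² + X₀³ + X₁³ + X₂³ + X₃³` over any field of characteristic 2 — `fermat_bad_germ_row_char2` (`hprime`/`hoff` from this seat's
  ✓ `BrieskornPhamSpecimen` with `c = 2`, `a_j = 3`, `ω = 1` — no `2 ≠ 0` needed; chart cubic `1 + ΣZ_i³` prime and Euler-smooth by lead-1's ✓ `X2Cubic4FloorTwoYChart`, `3 ≠ 0`
  in char 2). (The same germ row in the `z`-first letter `X₀² + ΣX_{l+1}³` is ✓ `HypersurfaceOriginNotFull.doublePoint_vertex_bad_germ_instance`; this is the class-route derivation.)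
  The CYCLIC cubic `Y₀²Y₁ + Y₁²Y₂ + Y₂²Y₃ + Y₃²Y₀` (smooth at `p = 2`, outside the Fermat family) is the sequel `…X2CyclicCubicChar2`.
[folklore mathematics, OURS as a certificate; cite: Fedder1983, Prop. 1.7 and Thm. 1.12; GortzWedhorn2020, Prop. 13.91 (2); StacksProject, Tag 0804]
-/

-- single-problem summit: the doubled namespace component is forced
set_option linter.dupNamespace false

noncomputable section

namespace Summit.ResolutionOfSingularities.ResolutionOfSingularities.Theorems.FInjectiveMacaulayfication.X2CubicFormFSideChar2

open CategoryTheory CategoryTheory.Limits AlgebraicGeometry TopologicalSpace IsLocalRing MvPolynomial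
open Literature.AlgebraicGeometry.Resolution
open Summit.ResolutionOfSingularities.ResolutionOfSingularities.Theorems.FInjectiveMacaulayfication
open SliceableCentre GermForm GermOfGlobalBlowup

variable (k : Type) [Field k]

/-! ## §1 The vertex is not F-pure in characteristic 2 -/

/-- A polynomial all of whose monomials contain the square of some variable lies in `(Y₀², …, Y_{m−1}²)`. [elementary] -/
theorem mem_span_sq_of_support {m : ℕ} (F : MvPolynomial (Fin m) k) (hsq : ∀ d ∈ F.support, ∃ i, 2 ≤ d i) :
    F ∈ Ideal.span (Set.range fun i : Fin m => (X i : MvPolynomial (Fin m) k) ^ 2) := by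
  classical
  rw [F.as_sum]
  refine Ideal.sum_mem _ fun d hd => ?_
  obtain ⟨i, hi⟩ := hsq d hd
  have hle : Finsupp.single i 2 ≤ d := Finsupp.single_le_iff.mpr hi
  have e : monomial d (coeff d F) = (X i : MvPolynomial (Fin m) k) ^ 2 * monomial (d - Finsupp.single i 2) (coeff d F) := by
    rw [X_pow_eq_monomial, monomial_mul, one_mul, add_tsub_cancel_of_le hle]
  rw [e]
  exact Ideal.mul_mem_right _ _ (Ideal.subset_span ⟨i, rfl⟩)

/-- Hence `F(X₀..X₃) ∈ (X₀², …, X₄²)` in `k[X₀..X₄]`. [elementary] -/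
theorem rename_mem_span_sq (F : MvPolynomial (Fin 4) k) (hsq : ∀ d ∈ F.support, ∃ i, 2 ≤ d i) :
    rename (Fin.castSucc : Fin 4 → Fin 5) F ∈ Ideal.span (Set.range fun j : Fin 5 => (X j : MvPolynomial (Fin 5) k) ^ 2) := by
  have h := Ideal.mem_map_of_mem (rename (Fin.castSucc : Fin 4 → Fin 5)).toRingHom (mem_span_sq_of_support k F hsq)
  rw [Ideal.map_span] at h
  refine (Ideal.span_le.mpr ?_) h
  rintro _ ⟨_, ⟨i, rfl⟩, rfl⟩
  exact Ideal.subset_span ⟨Fin.castSucc i, by simp [rename_X]⟩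

/-- ★ **THE VERTEX OF `x² + F₃` IS NOT F-PURE IN CHARACTERISTIC 2** when every monomial of the cubic form `F₃` contains a square (`F₃ ∈ (Y₀²,…,Y₃²)`; the Fermat and the cyclic
cubic are such): `f = X₄² + F₃ ∈ 𝔪^{[2]}`, i.e. `f^{p−1} ∈ 𝔪^{[p]}` for `p = 2` — Fedder at the vertex. [folklore; cite: Fedder1983, Prop. 1.7 and Thm. 1.12] -/
theorem vertex_not_fullCl_char2 [CharP k 2] (F : MvPolynomial (Fin 4) k) (hF : F.IsHomogeneous 3) (hsq : ∀ d ∈ F.support, ∃ i, 2 ≤ d i)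
    (f : MvPolynomial (Fin 5) k) (hf : f = X 4 ^ 2 + rename (Fin.castSucc : Fin 4 → Fin 5) F) (hprime : Prime f)
    (v : Spec (.of (MvPolynomial (Fin 5) k ⧸ Ideal.span {f})))
    (hv : v.asIdeal = Ideal.span (Set.range fun j : Fin 5 => Ideal.Quotient.mk (Ideal.span {f}) (X j))) :
    ¬ FullCl 2 ((Spec (.of (MvPolynomial (Fin 5) k ⧸ Ideal.span {f}))).presheaf.stalk v) := by
  haveI : Fact (Nat.Prime 2) := ⟨Nat.prime_two⟩
  refine HypersurfaceOriginNotFull.not_fullCl_stalk_origin_of_fedder_mem 2 k f hprime.ne_zero (X2CubicFormFrontEnd.constantCoeff_f k F hF f hf) ?_ v hv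
  rw [show (2 - 1 : ℕ) = 1 from rfl, pow_one, hf]
  exact Ideal.add_mem _ (Ideal.subset_span ⟨4, rfl⟩) (rename_mem_span_sq k F hsq)

/-! ## §2 ★ The class row: the point floor is the cure -/

/-- ★ **THE p = 2 SMOOTH-CUBIC F-SIDE CLASS ROW.** `char k = 2`; `F` a cubic form with every monomial containing a square; `f = X₄² + F` prime; `Y = Spec k[X]/(f)` regular off the
vertex `v`; the four dehomogenisations of `F` prime with pointwise-smooth zero locus. Then: (NOT FULL) `𝒪_{Y,v}` is not `FullCl 2`; (SCOPE) `v` closed, `v ∉ Reg Y`, `dim 𝒪_{Y,v} = 4`;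
and for EVERY blowing up `g : S′ → Spec 𝒪_{Y,v}` along the point floor `𝔪̃·𝒪_{Y,v}`: (LEGAL) centre `≠ ⊥`, supported in the non-regular locus, `S′` regular off the closed fibre, CM at
every stalk; (CURED BY THE FLOOR ITSELF) `S′` is `FullCl 2` at EVERY stalk. The middle conjunct of lead-1's ✓ `tStep_row_of_doublePoint_cubicForm` read on the F-side, plus §1.
[OURS · unconditional F-side class row of the simplest kind; cite: Fedder1983, Thm. 1.12; GortzWedhorn2020, Prop. 13.91 (2)] -/
theorem fSide_classRow_smoothCubic_char2 [CharP k 2] (F : MvPolynomial (Fin 4) k) (hF : F.IsHomogeneous 3) (hsq : ∀ d ∈ F.support, ∃ i, 2 ≤ d i)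
    (f : MvPolynomial (Fin 5) k) (hf : f = X 4 ^ 2 + rename (Fin.castSucc : Fin 4 → Fin 5) F) (hprime : Prime f)
    (hoff : ∀ (P : Ideal (MvPolynomial (Fin 5) k ⧸ Ideal.span {f})) [P.IsPrime],
      ¬ Ideal.span (Set.range fun j : Fin 5 => Ideal.Quotient.mk (Ideal.span {f}) (X j)) ≤ P → IsRegularLocalRing (Localization.AtPrime P))
    (hw : ∀ a : Fin 4, Prime (MvPolynomial.aeval ((![![1, X 0, X 1, X 2], ![X 0, 1, X 1, X 2], ![X 0, X 1, 1, X 2], ![X 0, X 1, X 2, 1]] :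
      Fin 4 → Fin 4 → MvPolynomial (Fin 3) k) a) F))
    (hws : ∀ (a : Fin 4) (Q : Ideal (MvPolynomial (Fin 3) k)), Q.IsPrime →
      MvPolynomial.aeval ((![![1, X 0, X 1, X 2], ![X 0, 1, X 1, X 2], ![X 0, X 1, 1, X 2], ![X 0, X 1, X 2, 1]] : Fin 4 → Fin 4 → MvPolynomial (Fin 3) k) a) F ∈ Q →
      ∃ D : Derivation k (MvPolynomial (Fin 3) k) (MvPolynomial (Fin 3) k),
        D (MvPolynomial.aeval ((![![1, X 0, X 1, X 2], ![X 0, 1, X 1, X 2], ![X 0, X 1, 1, X 2], ![X 0, X 1, X 2, 1]] : Fin 4 → Fin 4 → MvPolynomial (Fin 3) k) a) F) ∉ Q)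
    (v : Spec (.of (MvPolynomial (Fin 5) k ⧸ Ideal.span {f})))
    (hv : v.asIdeal = Ideal.span (Set.range fun j : Fin 5 => Ideal.Quotient.mk (Ideal.span {f}) (X j))) :
    ¬ FullCl 2 ((Spec (.of (MvPolynomial (Fin 5) k ⧸ Ideal.span {f}))).presheaf.stalk v) ∧
    (IsClosed ({v} : Set (Spec (.of (MvPolynomial (Fin 5) k ⧸ Ideal.span {f})))) ∧
      v ∉ Scheme.regularLocus (Spec (.of (MvPolynomial (Fin 5) k ⧸ Ideal.span {f}))) ∧
      ringKrullDim ((Spec (.of (MvPolynomial (Fin 5) k ⧸ Ideal.span {f}))).presheaf.stalk v) = (4 : ℕ)) ∧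
    (∀ (S' : Scheme.{0}) (g : S' ⟶ Spec ((Spec (.of (MvPolynomial (Fin 5) k ⧸ Ideal.span {f}))).presheaf.stalk v)),
      IsBlowup g ((affineBlowup.idealSheaf (Ideal.span (Set.range (fun j : Fin 5 => Ideal.Quotient.mk (Ideal.span {f}) (X j))))).comap
        ((Spec (.of (MvPolynomial (Fin 5) k ⧸ Ideal.span {f}))).fromSpecStalk v)) →
      (((affineBlowup.idealSheaf (Ideal.span (Set.range (fun j : Fin 5 => Ideal.Quotient.mk (Ideal.span {f}) (X j))))).comap
          ((Spec (.of (MvPolynomial (Fin 5) k ⧸ Ideal.span {f}))).fromSpecStalk v)) ≠ ⊥ ∧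
        (((((affineBlowup.idealSheaf (Ideal.span (Set.range (fun j : Fin 5 => Ideal.Quotient.mk (Ideal.span {f}) (X j))))).comap
            ((Spec (.of (MvPolynomial (Fin 5) k ⧸ Ideal.span {f}))).fromSpecStalk v))).support :
              Set (Spec ((Spec (.of (MvPolynomial (Fin 5) k ⧸ Ideal.span {f}))).presheaf.stalk v))) ⊆
            (Scheme.regularLocus (Spec ((Spec (.of (MvPolynomial (Fin 5) k ⧸ Ideal.span {f}))).presheaf.stalk v)))ᶜ) ∧
        (∀ s : S', g.base s ≠ closedPoint ((Spec (.of (MvPolynomial (Fin 5) k ⧸ Ideal.span {f}))).presheaf.stalk v) → s ∈ Scheme.regularLocus S') ∧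
        (∀ s : S', CMCl (S'.presheaf.stalk s))) ∧
      (∀ s : S', FullCl 2 (S'.presheaf.stalk s))) := by
  haveI : Fact (Nat.Prime 2) := ⟨Nat.prime_two⟩
  obtain ⟨hscope, hfloor, -⟩ := X2CubicFormTStepRow.tStep_row_of_doublePoint_cubicForm k 2 F hF f hf hprime hoff hw hws v hv
  refine ⟨vertex_not_fullCl_char2 k F hF hsq f hf hprime v hv, hscope, fun S' g hg => ?_⟩
  obtain ⟨hne, hsupp, hreg, hfull⟩ := hfloor S' g hg
  exact ⟨⟨hne, hsupp, hreg, fun s => RelClosedSubsetFixFinite.cmCl_of_fullCl (hfull s)⟩, hfull⟩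

/-- ★ **THE GERM FORM: `FInjectivizationGermAt 2 v`** for every member of the class (same hypotheses, `hsq` not even needed): the witness centre is the point floor `𝔪̃·𝒪_{Y,v}` and
the FULL model is `Bl_𝔪 Y` (lead-1's ✓ `X2CubicFormTStepRow.affineBlowup_fullCl`), via ✓ `GermOfGlobalBlowup.fInjectivizationGermAt_of_affineBlowup`. [folklore glue;
cite: GortzWedhorn2020, Prop. 13.91 (2); StacksProject, Tag 0804] -/
theorem fInjectivizationGermAt_smoothCubic_char2 [CharP k 2] (F : MvPolynomial (Fin 4) k) (hF : F.IsHomogeneous 3)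
    (f : MvPolynomial (Fin 5) k) (hf : f = X 4 ^ 2 + rename (Fin.castSucc : Fin 4 → Fin 5) F) (hprime : Prime f)
    (hoff : ∀ (P : Ideal (MvPolynomial (Fin 5) k ⧸ Ideal.span {f})) [P.IsPrime],
      ¬ Ideal.span (Set.range fun j : Fin 5 => Ideal.Quotient.mk (Ideal.span {f}) (X j)) ≤ P → IsRegularLocalRing (Localization.AtPrime P))
    (hw : ∀ a : Fin 4, Prime (MvPolynomial.aeval ((![![1, X 0, X 1, X 2], ![X 0, 1, X 1, X 2], ![X 0, X 1, 1, X 2], ![X 0, X 1, X 2, 1]] :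
      Fin 4 → Fin 4 → MvPolynomial (Fin 3) k) a) F))
    (hws : ∀ (a : Fin 4) (Q : Ideal (MvPolynomial (Fin 3) k)), Q.IsPrime →
      MvPolynomial.aeval ((![![1, X 0, X 1, X 2], ![X 0, 1, X 1, X 2], ![X 0, X 1, 1, X 2], ![X 0, X 1, X 2, 1]] : Fin 4 → Fin 4 → MvPolynomial (Fin 3) k) a) F ∈ Q →
      ∃ D : Derivation k (MvPolynomial (Fin 3) k) (MvPolynomial (Fin 3) k),
        D (MvPolynomial.aeval ((![![1, X 0, X 1, X 2], ![X 0, 1, X 1, X 2], ![X 0, X 1, 1, X 2], ![X 0, X 1, X 2, 1]] : Fin 4 → Fin 4 → MvPolynomial (Fin 3) k) a) F) ∉ Q)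
    (v : Spec (.of (MvPolynomial (Fin 5) k ⧸ Ideal.span {f})))
    (hv : v.asIdeal = Ideal.span (Set.range fun j : Fin 5 => Ideal.Quotient.mk (Ideal.span {f}) (X j))) :
    FInjectivizationGermAt 2 v := by
  haveI : Fact (Nat.Prime 2) := ⟨Nat.prime_two⟩
  haveI hfprime : (Ideal.span {f}).IsPrime := (Ideal.span_singleton_prime hprime.ne_zero).mpr hprime
  haveI : IsDomain (MvPolynomial (Fin 5) k ⧸ Ideal.span {f}) := Ideal.Quotient.isDomain _
  have hF0 : F ≠ 0 := by
    intro h0; have := (hw 0).ne_zero; rw [h0, map_zero] at this; exact this rfl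
  have hXf : (X 4 : MvPolynomial (Fin 5) k) ∉ Ideal.span {f} :=
    PrimeTransfer.X_not_mem_span_of_isPrime hfprime (X2CubicFormFrontEnd.f_not_mem_span_X k F hF hF0 f hf 4)
  have hI : Ideal.span (Set.range fun j : Fin 5 => Ideal.Quotient.mk (Ideal.span {f}) (X j)) ≠ ⊥ := fun hbot =>
    hXf (Ideal.Quotient.eq_zero_iff_mem.mp ((Ideal.mem_bot).mp (hbot ▸ Ideal.subset_span (Set.mem_range_self (4 : Fin 5)))))
  exact fInjectivizationGermAt_of_affineBlowup 2 _ hI v (hv ▸ Ideal.le_radical)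
    (X2CubicFormTStepRow.affineBlowup_fullCl k 2 F hF f hf hprime hoff hw hws)

/-- ★ **THE CENSUS PAIR `¬ FullCl 2 (𝒪_{Y,v}) ∧ FInjectivizationGermAt 2 v`** for every member of the class (`char k = 2`). [OURS · unconditional F-side class row] -/
theorem smoothCubic_bad_germ_row_char2 [CharP k 2] (F : MvPolynomial (Fin 4) k) (hF : F.IsHomogeneous 3) (hsq : ∀ d ∈ F.support, ∃ i, 2 ≤ d i)
    (f : MvPolynomial (Fin 5) k) (hf : f = X 4 ^ 2 + rename (Fin.castSucc : Fin 4 → Fin 5) F) (hprime : Prime f)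
    (hoff : ∀ (P : Ideal (MvPolynomial (Fin 5) k ⧸ Ideal.span {f})) [P.IsPrime],
      ¬ Ideal.span (Set.range fun j : Fin 5 => Ideal.Quotient.mk (Ideal.span {f}) (X j)) ≤ P → IsRegularLocalRing (Localization.AtPrime P))
    (hw : ∀ a : Fin 4, Prime (MvPolynomial.aeval ((![![1, X 0, X 1, X 2], ![X 0, 1, X 1, X 2], ![X 0, X 1, 1, X 2], ![X 0, X 1, X 2, 1]] :
      Fin 4 → Fin 4 → MvPolynomial (Fin 3) k) a) F))
    (hws : ∀ (a : Fin 4) (Q : Ideal (MvPolynomial (Fin 3) k)), Q.IsPrime →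
      MvPolynomial.aeval ((![![1, X 0, X 1, X 2], ![X 0, 1, X 1, X 2], ![X 0, X 1, 1, X 2], ![X 0, X 1, X 2, 1]] : Fin 4 → Fin 4 → MvPolynomial (Fin 3) k) a) F ∈ Q →
      ∃ D : Derivation k (MvPolynomial (Fin 3) k) (MvPolynomial (Fin 3) k),
        D (MvPolynomial.aeval ((![![1, X 0, X 1, X 2], ![X 0, 1, X 1, X 2], ![X 0, X 1, 1, X 2], ![X 0, X 1, X 2, 1]] : Fin 4 → Fin 4 → MvPolynomial (Fin 3) k) a) F) ∉ Q)
    (v : Spec (.of (MvPolynomial (Fin 5) k ⧸ Ideal.span {f})))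
    (hv : v.asIdeal = Ideal.span (Set.range fun j : Fin 5 => Ideal.Quotient.mk (Ideal.span {f}) (X j))) :
    ¬ FullCl 2 ((Spec (.of (MvPolynomial (Fin 5) k ⧸ Ideal.span {f}))).presheaf.stalk v) ∧ FInjectivizationGermAt 2 v :=
  ⟨vertex_not_fullCl_char2 k F hF hsq f hf hprime v hv, fInjectivizationGermAt_smoothCubic_char2 k F hF f hf hprime hoff hw hws v hv⟩

/-! ## §3 The Fermat member at `p = 2` through the class route -/

/-- Every monomial of the Fermat form `ΣY_j³` contains a square (indeed a cube). [elementary] -/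
theorem fermat_support_sq : ∀ d ∈ (X 0 ^ 3 + X 1 ^ 3 + X 2 ^ 3 + X 3 ^ 3 : MvPolynomial (Fin 4) k).support, ∃ i, 2 ≤ d i := by
  classical
  intro d hd
  simp only [X_pow_eq_monomial] at hd
  rcases Finset.mem_union.mp (support_add hd) with h | h
  · rcases Finset.mem_union.mp (support_add h) with h | h
    · rcases Finset.mem_union.mp (support_add h) with h | h
      · exact ⟨0, by rw [CensusBedsWeaklyNondegenerate.eq_of_mem_support_monomial h]; simp⟩
      · exact ⟨1, by rw [CensusBedsWeaklyNondegenerate.eq_of_mem_support_monomial h]; simp⟩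
    · exact ⟨2, by rw [CensusBedsWeaklyNondegenerate.eq_of_mem_support_monomial h]; simp⟩
  · exact ⟨3, by rw [CensusBedsWeaklyNondegenerate.eq_of_mem_support_monomial h]; simp⟩

/-- ★ **THE FERMAT MEMBER AT `p = 2`**: for every field `k` of characteristic 2 and `f = X₄² + (Y₀³+Y₁³+Y₂³+Y₃³)(X₀..X₃)`, the full F-side class row of §2 — vertex not F-pure, scope,
point floor LEGAL and FULL at every stalk. `hprime`/`hoff` come from this seat's Brieskorn–Pham specimen (`c = 2`, `a_j = 3`, `ω = 1`: no `2 ≠ 0` needed), the chart cubic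
`1 + ΣZ_i³` is prime and Euler-smooth by lead-1's ✓ `X2Cubic4FloorTwoYChart` (`3 ≠ 0` in characteristic 2). [OURS · instance of the class row] -/
theorem fermat_fSide_row_char2 [CharP k 2] (f : MvPolynomial (Fin 5) k)
    (hf : f = X 4 ^ 2 + rename (Fin.castSucc : Fin 4 → Fin 5) (X 0 ^ 3 + X 1 ^ 3 + X 2 ^ 3 + X 3 ^ 3 : MvPolynomial (Fin 4) k))
    (v : Spec (.of (MvPolynomial (Fin 5) k ⧸ Ideal.span {f})))
    (hv : v.asIdeal = Ideal.span (Set.range fun j : Fin 5 => Ideal.Quotient.mk (Ideal.span {f}) (X j))) :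
    ¬ FullCl 2 ((Spec (.of (MvPolynomial (Fin 5) k ⧸ Ideal.span {f}))).presheaf.stalk v) ∧
    (IsClosed ({v} : Set (Spec (.of (MvPolynomial (Fin 5) k ⧸ Ideal.span {f})))) ∧
      v ∉ Scheme.regularLocus (Spec (.of (MvPolynomial (Fin 5) k ⧸ Ideal.span {f}))) ∧
      ringKrullDim ((Spec (.of (MvPolynomial (Fin 5) k ⧸ Ideal.span {f}))).presheaf.stalk v) = (4 : ℕ)) ∧
    (∀ (S' : Scheme.{0}) (g : S' ⟶ Spec ((Spec (.of (MvPolynomial (Fin 5) k ⧸ Ideal.span {f}))).presheaf.stalk v)),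
      IsBlowup g ((affineBlowup.idealSheaf (Ideal.span (Set.range (fun j : Fin 5 => Ideal.Quotient.mk (Ideal.span {f}) (X j))))).comap
        ((Spec (.of (MvPolynomial (Fin 5) k ⧸ Ideal.span {f}))).fromSpecStalk v)) →
      (((affineBlowup.idealSheaf (Ideal.span (Set.range (fun j : Fin 5 => Ideal.Quotient.mk (Ideal.span {f}) (X j))))).comap
          ((Spec (.of (MvPolynomial (Fin 5) k ⧸ Ideal.span {f}))).fromSpecStalk v)) ≠ ⊥ ∧
        (((((affineBlowup.idealSheaf (Ideal.span (Set.range (fun j : Fin 5 => Ideal.Quotient.mk (Ideal.span {f}) (X j))))).comap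
            ((Spec (.of (MvPolynomial (Fin 5) k ⧸ Ideal.span {f}))).fromSpecStalk v))).support :
              Set (Spec ((Spec (.of (MvPolynomial (Fin 5) k ⧸ Ideal.span {f}))).presheaf.stalk v))) ⊆
            (Scheme.regularLocus (Spec ((Spec (.of (MvPolynomial (Fin 5) k ⧸ Ideal.span {f}))).presheaf.stalk v)))ᶜ) ∧
        (∀ s : S', g.base s ≠ closedPoint ((Spec (.of (MvPolynomial (Fin 5) k ⧸ Ideal.span {f}))).presheaf.stalk v) → s ∈ Scheme.regularLocus S') ∧
        (∀ s : S', CMCl (S'.presheaf.stalk s))) ∧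
      (∀ s : S', FullCl 2 (S'.presheaf.stalk s))) ∧
    FInjectivizationGermAt 2 v := by
  have h3 : (3 : k) ≠ 0 := by
    intro h
    have h2 : (2 : k) = 0 := by exact_mod_cast CharP.cast_eq_zero k 2
    have : (1 : k) = 0 := by linear_combination h - h2
    exact one_ne_zero this
  have h3' : ((3 : ℕ) : k) ≠ 0 := by exact_mod_cast h3
  have hω : (1 : k) ^ 3 + 1 = 0 := by
    have h2 : (2 : k) = 0 := by exact_mod_cast CharP.cast_eq_zero k 2
    linear_combination h2
  have hf' := X2CubicFormFermat.f_eq k f hf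
  have hprime : Prime f := BrieskornPhamSpecimen.prime_f k 2 3 3 3 3 le_rfl (by norm_num) (by norm_num) h3' 1 hω f hf'
  have hoff : ∀ (P : Ideal (MvPolynomial (Fin 5) k ⧸ Ideal.span {f})) [P.IsPrime],
      ¬ Ideal.span (Set.range fun j : Fin 5 => Ideal.Quotient.mk (Ideal.span {f}) (X j)) ≤ P → IsRegularLocalRing (Localization.AtPrime P) :=
    fun P _ hP => BrieskornPhamSpecimen.regular_off_vertex k 2 3 3 3 3 le_rfl (by norm_num) (by norm_num) (by norm_num) (by norm_num) h3' h3' h3' h3' f hf' P hP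
  have hw : ∀ a : Fin 4, Prime (MvPolynomial.aeval ((![![1, X 0, X 1, X 2], ![X 0, 1, X 1, X 2], ![X 0, X 1, 1, X 2], ![X 0, X 1, X 2, 1]] :
      Fin 4 → Fin 4 → MvPolynomial (Fin 3) k) a) (X 0 ^ 3 + X 1 ^ 3 + X 2 ^ 3 + X 3 ^ 3 : MvPolynomial (Fin 4) k)) := fun a => by
    rw [X2CubicFormFermat.dehomogenisation_fermat]
    exact X2Cubic4FloorTwoYChart.prime_g k h3 _ rfl
  have hws : ∀ (a : Fin 4) (Q : Ideal (MvPolynomial (Fin 3) k)), Q.IsPrime →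
      MvPolynomial.aeval ((![![1, X 0, X 1, X 2], ![X 0, 1, X 1, X 2], ![X 0, X 1, 1, X 2], ![X 0, X 1, X 2, 1]] : Fin 4 → Fin 4 → MvPolynomial (Fin 3) k) a)
        (X 0 ^ 3 + X 1 ^ 3 + X 2 ^ 3 + X 3 ^ 3 : MvPolynomial (Fin 4) k) ∈ Q →
      ∃ D : Derivation k (MvPolynomial (Fin 3) k) (MvPolynomial (Fin 3) k),
        D (MvPolynomial.aeval ((![![1, X 0, X 1, X 2], ![X 0, 1, X 1, X 2], ![X 0, X 1, 1, X 2], ![X 0, X 1, X 2, 1]] : Fin 4 → Fin 4 → MvPolynomial (Fin 3) k) a)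
          (X 0 ^ 3 + X 1 ^ 3 + X 2 ^ 3 + X 3 ^ 3 : MvPolynomial (Fin 4) k)) ∉ Q := fun a Q hQ hQa => by
    rw [X2CubicFormFermat.dehomogenisation_fermat] at hQa ⊢
    exact X2YGBlowupRegularLocal.pointwise_of_isUnit (1 + X 0 ^ 3 + X 1 ^ 3 + X 2 ^ 3 : MvPolynomial (Fin 3) k) _
      (X2Cubic4FloorTwoYChart.isUnit_mk_euler_g k h3 _ rfl) Q hQ hQa
  obtain ⟨hnf, hscope, hrow⟩ := fSide_classRow_smoothCubic_char2 k _ (X2CubicFormFermat.fermat_isHomogeneous k) (fermat_support_sq k) f hf hprime hoff hw hws v hv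
  exact ⟨hnf, hscope, hrow, fInjectivizationGermAt_smoothCubic_char2 k _ (X2CubicFormFermat.fermat_isHomogeneous k) f hf hprime hoff hw hws v hv⟩

/-- **The Fermat member at `p = 2`, census pair**: `¬ FullCl 2 (𝒪_{Y,v}) ∧ FInjectivizationGermAt 2 v`. [OURS · instance] -/
theorem fermat_bad_germ_row_char2 [CharP k 2] (f : MvPolynomial (Fin 5) k)
    (hf : f = X 4 ^ 2 + rename (Fin.castSucc : Fin 4 → Fin 5) (X 0 ^ 3 + X 1 ^ 3 + X 2 ^ 3 + X 3 ^ 3 : MvPolynomial (Fin 4) k))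
    (v : Spec (.of (MvPolynomial (Fin 5) k ⧸ Ideal.span {f})))
    (hv : v.asIdeal = Ideal.span (Set.range fun j : Fin 5 => Ideal.Quotient.mk (Ideal.span {f}) (X j))) :
    ¬ FullCl 2 ((Spec (.of (MvPolynomial (Fin 5) k ⧸ Ideal.span {f}))).presheaf.stalk v) ∧ FInjectivizationGermAt 2 v :=
  ⟨(fermat_fSide_row_char2 k f hf v hv).1, (fermat_fSide_row_char2 k f hf v hv).2.2.2⟩

end Summit.ResolutionOfSingularities.ResolutionOfSingularities.Theorems.FInjectiveMacaulayfication.X2CubicFormFSideChar2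

end
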